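import Literature.NumberTheory.DiophantineGeometry.FunctionFieldRayClasses
import Literature.NumberTheory.DiophantineGeometry.FunctionFieldZetaRationalityProofs
import Mathlib.RingTheory.PowerSeries.Trunc
import HarnessLib

/-!
# The `L`-series of a ray class character of a function field is a polynomial (Rosen Ch. 9 / Weil)

Let `F/K` be an algebraic function field of one variable over the finite field `K = 𝔽_q` (its full
constant field), `P` a place and `N ≥ 1`. For a function `χ` on divisors we form the `L`-series away
from `P`,
`L(χ, t) = Σ_{D ≥ 0, P ∉ supp D} χ(D) t^{deg D} ∈ ℂ⟦t⟧` (`rayClassLSeries`, coefficients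
`rayClassCoeff`). The main theorem of this file is the classical polynomiality statement for ray
class characters (F. K. Schmidt 1931, Hasse 1934, Weil; M. Rosen, *Number Theory in Function Fields*,
Ch. 9, in the ideal-theoretic language `L(s, χ) = Σ_A χ(A) NA^{-s}`):

* `rayClassCoeff_eq_zero`: if `χ` is constant on ray classes modulo `P^N` (sibling file
  `FunctionFieldRayClasses`: `RayEquiv`) and is multiplied by some `ζ ≠ 1` under translation by a
  divisor `D₁` of degree `0` prime to `P` (i.e. `χ` is a *nontrivial* — "ramified or geometrically
  nontrivial" — ray class function), then `Σ_{D ≥ 0, deg D = d, P ∉ supp D} χ(D) = 0` for all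
  `d > 2g - 2 + N deg P`. The proof is a double count over pairs `(D, D')` with `D' ∼ D + D₁`, using
  that every ray class of degree `d` prime to `P` contains the same positive number of positive
  divisors (`natCard_nonneg_rayEquiv`, Riemann–Roch);
* `rayClassLSeries_eq_trunc`, `exists_polynomial_eq_rayClassLSeries`: hence `L(χ, t)` is a polynomial
  of degree `≤ 2g - 2 + N deg P`;
* `AddChar.exists_polynomial_eq_rayClassLSeries`, `AddChar.rayClassCoeff_eq_zero`: the same for a
  character `χ` of the divisor group trivial on the divisors of ray functions and nontrivial on some
  divisor of degree `0` prime to `P` — the form used for the `L`-functions `L(E, ω·(ψ∘f), t)` of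
  Kohel–Shparlinski (`Literature.NumberTheory.EllipticCurves.KohelShparlinskiCharacterSums`, modulus
  `(n+1)·O` on an elliptic function field, giving degree `≤ n + 1`);
* `rayClassCoeff_zero`: the constant coefficient is `χ(0)`.

Everything is proved; no named facts.

## References

* M. Rosen, *Number Theory in Function Fields*, GTM 210, Springer 2002, Ch. 9. [RosenFunctionFields2002]
* H. Stichtenoth, *Algebraic Function Fields and Codes*, 2nd ed., GTM 254, Springer 2009,
  Lemma 5.1.1, Lemma 5.1.4, Thm. 5.1.15. [Stichtenoth2009]
* A. Weil, *Basic Number Theory*, Springer 1974, Ch. VII §7 (the `L`-functions of a function field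
  are polynomials), as cited in [KohelShparlinski2000, Prop. 1].
-/

noncomputable section

open scoped Classical

namespace Literature.NumberTheory.DiophantineGeometry.AlgFunctionField

universe u v

variable {K : Type u} {F : Type v} [Field K] [Field F] [Algebra K F]

/-! ### The `L`-series of a function on divisors, away from `P` -/

section LSeriesDefs

variable (P : PlaceOver K F)

/-- The positive divisors of degree `d` prime to `P` (a finite set over a finite constant field,
Stichtenoth Lemma 5.1.1). [cite: Stichtenoth2009, Lemma 5.1.1] -/
abbrev PosDivPrimeTo (d : ℕ) : Type v :=
  {D : Divisor K F // 0 ≤ D ∧ D.degree = d ∧ D P = 0}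

/-- The coefficients of the `L`-series of a function `χ` on divisors with respect to the place `P`:
`a_d(χ) = Σ_{D ≥ 0, deg D = d, P ∉ supp D} χ(D)` (Rosen Ch. 9: `L(s, χ) = Σ_{A ≥ 0 prime to 𝔪} χ(A) NA^{-s}`,
grouped by degree; a `finsum`, meaningful when the index set is finite, e.g. over a finite constant
field). [cite: RosenFunctionFields2002, Ch. 9] -/
def rayClassCoeff (χ : Divisor K F → ℂ) (d : ℕ) : ℂ :=
  ∑ᶠ D : PosDivPrimeTo P d, χ D

/-- **The `L`-series `L(χ, t) = Σ_{D ≥ 0, P ∉ supp D} χ(D) t^{deg D}`** of a function `χ` on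
divisors, away from the place `P`, as a formal power series over `ℂ` (Rosen Ch. 9, with `t = q^{-s}`).
[cite: RosenFunctionFields2002, Ch. 9] -/
def rayClassLSeries (χ : Divisor K F → ℂ) : PowerSeries ℂ :=
  PowerSeries.mk (rayClassCoeff P χ)

/-- The coefficients of `rayClassLSeries`. [folklore] -/
@[simp]
theorem coeff_rayClassLSeries (χ : Divisor K F → ℂ) (d : ℕ) :
    PowerSeries.coeff d (rayClassLSeries P χ) = rayClassCoeff P χ d := by
  simp [rayClassLSeries]

/-- The coefficient as a finite sum, once a `Fintype` structure is chosen. [folklore] -/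
theorem rayClassCoeff_eq_sum (χ : Divisor K F → ℂ) (d : ℕ) [Fintype (PosDivPrimeTo P d)] :
    rayClassCoeff P χ d = ∑ D : PosDivPrimeTo P d, χ D :=
  finsum_eq_sum_of_fintype _

end LSeriesDefs

/-! ### Vanishing of the coefficients of large degree; polynomiality -/

section LSeries

variable [IsAlgFunctionField K F] {P : PlaceOver K F} {N : ℕ}

variable (P) in
/-- Over a finite constant field there are finitely many positive divisors of degree `d` prime to
`P`. [cite: Stichtenoth2009, Lemma 5.1.1] -/
instance PosDivPrimeTo.finite [Finite K] (d : ℕ) : Finite (PosDivPrimeTo P d) :=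
  Finite.of_injective (fun D : PosDivPrimeTo P d =>
      (⟨D.1, D.2.1, D.2.2.1⟩ : {D : Divisor K F // 0 ≤ D ∧ D.degree = d}))
    (fun D D' h => Subtype.ext (by simpa using congrArg Subtype.val h))

/-- The constant coefficient is `χ(0)` (the only positive divisor of degree `0` is `0`). [folklore] -/
theorem rayClassCoeff_zero (χ : Divisor K F → ℂ) : rayClassCoeff P χ 0 = χ 0 := by
  have huniq : ∀ D : PosDivPrimeTo P 0, D = ⟨0, le_rfl, by simp, by simp⟩ := fun D =>
    Subtype.ext (Divisor.eq_zero_of_nonneg_of_degree_eq_zero D.2.1 (by exact_mod_cast D.2.2.1))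
  haveI : Unique (PosDivPrimeTo P 0) := ⟨⟨⟨0, le_rfl, by simp, by simp⟩⟩, huniq⟩
  rw [rayClassCoeff, finsum_unique, huniq default]

/-- The positive divisors of degree `d` prime to `P` which are ray-equivalent to a divisor `E` prime
to `P` of degree `d` are all the positive divisors ray-equivalent to `E`. [folklore] -/
def posDivPrimeToRayEquivEquiv (hN : 1 ≤ N) {d : ℕ} {E : Divisor K F} (hEP : E P = 0)
    (hEd : E.degree = d) :
    {D : PosDivPrimeTo P d // RayEquiv K P N D.1 E} ≃
      {D : Divisor K F // 0 ≤ D ∧ RayEquiv K P N D E} where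
  toFun D := ⟨D.1.1, D.1.2.1, D.2⟩
  invFun D := ⟨⟨D.1, D.2.1, D.2.2.degree_eq.trans hEd, (D.2.2.apply_eq hN).trans hEP⟩, D.2.2⟩
  left_inv _ := rfl
  right_inv _ := rfl

/-- **Vanishing of the coefficients of large degree** (the heart of the polynomiality of ray class
`L`-functions; Rosen Ch. 9 / Weil): let `N ≥ 1` and `χ` be a function on divisors which is constant
on ray classes modulo `P^N` and which is multiplied by a constant `ζ ≠ 1` under translation by some
divisor `D₁` of degree `0` prime to `P` ("`χ` is nontrivial on ray classes of degree `0`"). Then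
`Σ_{D ≥ 0, deg D = d, P ∉ supp D} χ(D) = 0` for every `d > 2g - 2 + N deg P`. Proof: double count
`Σ_{(D, D')} χ(D')` over the pairs of such divisors with `D' ∼ D + D₁`; every ray class of degree `d`
prime to `P` contains the same number `c > 0` of positive divisors (`natCard_nonneg_rayEquiv`), so the
sum is both `c ζ Σ_D χ(D)` and `c Σ_{D'} χ(D')`. [cite: RosenFunctionFields2002, Ch. 9] -/
theorem rayClassCoeff_eq_zero [Finite K] [IsIntegrallyClosedIn K F] (hN : 1 ≤ N)
    {χ : Divisor K F → ℂ} (hχ : ∀ D E : Divisor K F, RayEquiv K P N D E → χ D = χ E)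
    {D₁ : Divisor K F} (hD₁P : D₁ P = 0) (hD₁d : D₁.degree = 0) {ζ : ℂ} (hζ : ζ ≠ 1)
    (hχD₁ : ∀ D : Divisor K F, χ (D + D₁) = ζ * χ D)
    {d : ℕ} (hd : 2 * (genus K F : ℤ) - 2 < d - N * P.degree) :
    rayClassCoeff P χ d = 0 := by
  letI inst : Fintype (PosDivPrimeTo P d) := Fintype.ofFinite _
  rw [rayClassCoeff_eq_sum]
  -- if there is no positive divisor of degree `d` prime to `P`, the sum is empty
  by_cases hT : IsEmpty (PosDivPrimeTo P d)
  · exact Fintype.sum_empty _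
  obtain ⟨D₀⟩ := not_isEmpty_iff.1 hT
  -- the common number `c` of positive divisors in a ray class of degree `d` prime to `P`
  set c := Nat.card {D : Divisor K F // 0 ≤ D ∧ RayEquiv K P N D D₀.1} with hc
  have hdeg₀ : 2 * (genus K F : ℤ) - 2 < D₀.1.degree - N * P.degree := by rw [D₀.2.2.1]; exact hd
  have hcpos : 0 < c := natCard_nonneg_rayEquiv_pos hN D₀.2.2.2 hdeg₀
  have hcE : ∀ E : Divisor K F, E P = 0 → E.degree = d →
      Nat.card {D : Divisor K F // 0 ≤ D ∧ RayEquiv K P N D E} = c := fun E hEP hEd =>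
    natCard_nonneg_rayEquiv_eq_of_degree_eq hN hEP D₀.2.2.2 (hEd.trans D₀.2.2.1.symm)
      (by rw [hEd]; exact hd)
  -- the relation `D' ∼ D + D₁` and its fibres
  let R : PosDivPrimeTo P d → PosDivPrimeTo P d → Prop := fun D D' => RayEquiv K P N D'.1 (D.1 + D₁)
  have hfib₁ : ∀ D : PosDivPrimeTo P d, (Finset.univ.filter fun D' => R D D').card = c := by
    intro D
    have hEP : (D.1 + D₁) P = 0 := by rw [Finsupp.add_apply, D.2.2.2, hD₁P, add_zero]
    have hEd : (D.1 + D₁).degree = d := by rw [map_add, D.2.2.1, hD₁d, add_zero]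
    rw [← hcE _ hEP hEd, ← Nat.card_congr (posDivPrimeToRayEquivEquiv hN hEP hEd),
      Nat.card_eq_fintype_card, Fintype.card_subtype]
  have hfib₂ : ∀ D' : PosDivPrimeTo P d, (Finset.univ.filter fun D => R D D').card = c := by
    intro D'
    have hEP : (D'.1 - D₁) P = 0 := by rw [Finsupp.sub_apply, D'.2.2.2, hD₁P, sub_zero]
    have hEd : (D'.1 - D₁).degree = d := by rw [map_sub, D'.2.2.1, hD₁d, sub_zero]
    have hR : ∀ D : PosDivPrimeTo P d, R D D' ↔ RayEquiv K P N D.1 (D'.1 - D₁) := fun D => by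
      change RayEquiv K P N D'.1 (D.1 + D₁) ↔ _
      rw [← RayEquiv.sub_left_iff]
      exact ⟨RayEquiv.symm hN, RayEquiv.symm hN⟩
    rw [← hcE _ hEP hEd, ← Nat.card_congr (posDivPrimeToRayEquivEquiv hN hEP hEd),
      ← Nat.card_congr (Equiv.subtypeEquivRight hR), Nat.card_eq_fintype_card, Fintype.card_subtype]
  -- double count
  have key : ∑ D : PosDivPrimeTo P d, ∑ D' : PosDivPrimeTo P d, (if R D D' then χ D'.1 else 0) =
      ∑ D' : PosDivPrimeTo P d, ∑ D : PosDivPrimeTo P d, (if R D D' then χ D'.1 else 0) :=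
    Finset.sum_comm
  have lhs : ∑ D : PosDivPrimeTo P d, ∑ D' : PosDivPrimeTo P d, (if R D D' then χ D'.1 else 0) =
      c * (ζ * ∑ D : PosDivPrimeTo P d, χ D.1) := by
    rw [Finset.mul_sum, Finset.mul_sum]
    refine Finset.sum_congr rfl fun D _ => ?_
    have hrw : ∀ D' : PosDivPrimeTo P d,
        (if R D D' then χ D'.1 else 0) = if R D D' then ζ * χ D.1 else 0 := by
      intro D'
      split_ifs with h
      · rw [hχ _ _ h, hχD₁]
      · rfl
    rw [Finset.sum_congr rfl fun D' _ => hrw D', Finset.sum_ite, Finset.sum_const_zero, add_zero,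
      Finset.sum_const, hfib₁ D, nsmul_eq_mul]
  have rhs : ∑ D' : PosDivPrimeTo P d, ∑ D : PosDivPrimeTo P d, (if R D D' then χ D'.1 else 0) =
      c * ∑ D' : PosDivPrimeTo P d, χ D'.1 := by
    rw [Finset.mul_sum]
    refine Finset.sum_congr rfl fun D' _ => ?_
    rw [Finset.sum_ite, Finset.sum_const_zero, add_zero, Finset.sum_const, hfib₂ D', nsmul_eq_mul]
  rw [lhs, rhs] at key
  have hc0 : (c : ℂ) ≠ 0 := by exact_mod_cast hcpos.ne'
  have key' := mul_left_cancel₀ hc0 key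
  have hS : (ζ - 1) * ∑ D : PosDivPrimeTo P d, χ D.1 = 0 := by
    rw [sub_mul, one_mul, key', sub_self]
  rcases mul_eq_zero.1 hS with h | h
  · exact absurd (sub_eq_zero.1 h) hζ
  · exact h

/-- **Polynomiality of the `L`-series of a nontrivial ray class function** (Rosen Ch. 9 / Weil):
under the hypotheses of `rayClassCoeff_eq_zero`, `L(χ, t)` is a polynomial of degree
`≤ 2g - 2 + N deg P`: it equals its truncation at that order. [cite: RosenFunctionFields2002, Ch. 9] -/
theorem rayClassLSeries_eq_trunc [Finite K] [IsIntegrallyClosedIn K F] (hN : 1 ≤ N)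
    {χ : Divisor K F → ℂ} (hχ : ∀ D E : Divisor K F, RayEquiv K P N D E → χ D = χ E)
    {D₁ : Divisor K F} (hD₁P : D₁ P = 0) (hD₁d : D₁.degree = 0) {ζ : ℂ} (hζ : ζ ≠ 1)
    (hχD₁ : ∀ D : Divisor K F, χ (D + D₁) = ζ * χ D) :
    rayClassLSeries P χ =
      (PowerSeries.trunc (2 * genus K F - 2 + N * P.degree + 1) (rayClassLSeries P χ) : PowerSeries ℂ) := by
  ext d
  rw [Polynomial.coeff_coe, PowerSeries.coeff_trunc]
  split_ifs with h
  · rfl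
  · rw [coeff_rayClassLSeries]
    refine rayClassCoeff_eq_zero hN hχ hD₁P hD₁d hζ hχD₁ ?_
    push Not at h
    have h' : 2 * genus K F - 2 + N * P.degree < d := by omega
    zify at h'
    omega

/-- Hence `L(χ, t) ∈ ℂ[t]` with `deg L(χ, t) ≤ 2g - 2 + N deg P` (for `2g - 2 + N deg P ≥ 0`,
which holds unless `g = 0` and `N deg P ≤ 1`; in general the bound is the truncated natural number
`2g - 2 + N deg P`). [cite: RosenFunctionFields2002, Ch. 9] -/
theorem exists_polynomial_eq_rayClassLSeries [Finite K] [IsIntegrallyClosedIn K F] (hN : 1 ≤ N)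
    {χ : Divisor K F → ℂ} (hχ : ∀ D E : Divisor K F, RayEquiv K P N D E → χ D = χ E)
    {D₁ : Divisor K F} (hD₁P : D₁ P = 0) (hD₁d : D₁.degree = 0) {ζ : ℂ} (hζ : ζ ≠ 1)
    (hχD₁ : ∀ D : Divisor K F, χ (D + D₁) = ζ * χ D) :
    ∃ L : Polynomial ℂ, L.natDegree ≤ 2 * genus K F - 2 + N * P.degree ∧
      (L : PowerSeries ℂ) = rayClassLSeries P χ := by
  refine ⟨PowerSeries.trunc (2 * genus K F - 2 + N * P.degree + 1) (rayClassLSeries P χ), ?_,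
    (rayClassLSeries_eq_trunc hN hχ hD₁P hD₁d hζ hχD₁).symm⟩
  have := PowerSeries.natDegree_trunc_lt (rayClassLSeries P χ) (2 * genus K F - 2 + N * P.degree)
  omega

/-! ### Specialisation to characters of the divisor group -/

omit [IsAlgFunctionField K F] in
/-- For a character `χ` of the divisor group which is trivial on the divisors of ray functions,
`χ` is constant on ray classes. [folklore] -/
theorem AddChar.apply_eq_of_rayEquiv {χ : AddChar (Divisor K F) ℂ}
    (hray : ∀ h : F, h ∈ P.ray N → h ≠ 0 → χ (principalDivisor K h) = 1) {D E : Divisor K F}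
    (hDE : RayEquiv K P N D E) : χ D = χ E := by
  obtain ⟨h, hh, h0, rfl⟩ := hDE
  rw [AddChar.map_add_eq_mul, hray h hh h0, mul_one]

/-- **Polynomiality of ray class `L`-functions** (Rosen Ch. 9, for the modulus `N·P`): if a character
`χ` of the divisor group is trivial on the divisors of the functions `h ≡ 1 (mod 𝔪_P^N)` (`N ≥ 1`) and
nontrivial on some divisor of degree `0` prime to `P`, then `L(χ, t) = Σ_{D ≥ 0, P ∉ supp D} χ(D)t^{deg D}`
is a polynomial of degree `≤ 2g - 2 + N deg P`. [cite: RosenFunctionFields2002, Ch. 9] -/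
theorem AddChar.exists_polynomial_eq_rayClassLSeries [Finite K] [IsIntegrallyClosedIn K F]
    (hN : 1 ≤ N) (χ : AddChar (Divisor K F) ℂ)
    (hray : ∀ h : F, h ∈ P.ray N → h ≠ 0 → χ (principalDivisor K h) = 1)
    {D₁ : Divisor K F} (hD₁P : D₁ P = 0) (hD₁d : D₁.degree = 0) (hχD₁ : χ D₁ ≠ 1) :
    ∃ L : Polynomial ℂ, L.natDegree ≤ 2 * genus K F - 2 + N * P.degree ∧
      (L : PowerSeries ℂ) = rayClassLSeries P χ :=
  _root_.Literature.NumberTheory.DiophantineGeometry.AlgFunctionField.exists_polynomial_eq_rayClassLSeries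
    hN (fun _ _ h => AddChar.apply_eq_of_rayEquiv hray h) hD₁P hD₁d hχD₁
    (fun D => by rw [AddChar.map_add_eq_mul, mul_comm])

/-- The coefficients of large degree of a ray class character vanish. [cite: RosenFunctionFields2002, Ch. 9] -/
theorem AddChar.rayClassCoeff_eq_zero [Finite K] [IsIntegrallyClosedIn K F]
    (hN : 1 ≤ N) (χ : AddChar (Divisor K F) ℂ)
    (hray : ∀ h : F, h ∈ P.ray N → h ≠ 0 → χ (principalDivisor K h) = 1)
    {D₁ : Divisor K F} (hD₁P : D₁ P = 0) (hD₁d : D₁.degree = 0) (hχD₁ : χ D₁ ≠ 1)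
    {d : ℕ} (hd : 2 * (genus K F : ℤ) - 2 < d - N * P.degree) :
    rayClassCoeff P χ d = 0 :=
  _root_.Literature.NumberTheory.DiophantineGeometry.AlgFunctionField.rayClassCoeff_eq_zero hN
    (fun _ _ h => AddChar.apply_eq_of_rayEquiv hray h) hD₁P hD₁d hχD₁
    (fun D => by rw [AddChar.map_add_eq_mul, mul_comm]) hd

end LSeries

end Literature.NumberTheory.DiophantineGeometry.AlgFunctionField
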